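/-
HONEST FRAMING: systematic search; no irrationality claim unless certified.
-/
import Summits.KontsevichZagierPeriods.Zeta5Search.WedgeDictionaryAnchor1
import Summits.KontsevichZagierPeriods.Zeta5Search.WedgeDictionaryRowsB
import Summits.KontsevichZagierPeriods.Zeta5Search.SymRayExplicitPQ
import HarnessLib

/-!
# Diagonal anchoring: `explicitPQ` from THREE level-1 values and Brown–Zudilin's published diagonal facts

HONEST FRAMING: systematic search; no irrationality claim unless certified.
OUR work (Summit side; cell `pub-zeta5`, planner gen-1 g17, 2026-08-21, re-rendered by gen-1 g18; memo
`pub-zeta5-gen-1/D2-TERMINAL-g17.md` §5b).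

`Rows.explicitPQ_of_data4` (file `WedgeDictionaryRowsB`) reduces `explicitPQ` to four level-1 values `D1, D2, D16, D17` (modulo
the contiguity families and the cited invariance (27)).  The anchoring certificate `Anchor1.explicitPQAt_of_data` (file
`WedgeDictionaryAnchor1`; 54 relation instances, exact over `ℚ`) derives the AXIS value `D1` from `D2`, `D17` and the dictionary
identity at the diagonal point `a = 1⁸` (dual coordinates `(3;1⁷)`), which the tree proves from the two named facts `I_solvesRec`,
`I_init` of [BrownZudilin2022, Sect. 2] (`SymRay.explicitPQ_diag`).  Hence `Rows.explicitPQ_of_data3`: the families, (27), the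
two named facts and THREE level-1 values (`D2` single slot, `D16` ghost pair, `D17` top pair) imply `explicitPQ`; and
`Rows.explicitPQ_of_data3'` with the BRIDGE dictionary relation discharged by the tree's `Elimination.dictBridge_holds`.
Nothing analytic is proved here; nothing about irrationality. [folklore]
-/

noncomputable section

open Finset

namespace Summit.KontsevichZagierPeriods.Zeta5Search.WedgeDictionary

open Summit.KontsevichZagierPeriods.Zeta5Search.DualSeries
open Literature.NumberTheory.Irrationality.BrownZudilin2022
open Literature.NumberTheory.Transcendental (zetaValue)

/-- The tree's diagonal theorem in `ExplicitPQAt` form: the dictionary identity at `a = n·1⁸`, partner `1`, from the two named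
facts of [BrownZudilin2022, Sect. 2]. -/
theorem explicitPQAt_aDiag (hrec : I_solvesRec) (hinit : I_init) (n : ℕ) : ExplicitPQAt (SymRay.aDiag n) 1 := by
  unfold ExplicitPQAt dictPhat dictP
  exact SymRay.explicitPQ_diag hrec hinit n

/-- The diagonal point `a = 1⁸` as a vector literal. [folklore] -/
theorem aDiag_one : SymRay.aDiag 1 = ![1,1,1,1,1,1,1,1] := by
  ext i; fin_cases i <;> rfl

namespace Rows

/-- **The axis value from the diagonal.** `D1 = ExplicitPQAt (1,0,1,0,1,1,1,1) 1` follows from `D2`, `D17`, the contiguity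
families and the two named facts of [BrownZudilin2022, Sect. 2] (anchoring certificate `Anchor1`). [folklore] -/
theorem D1_of_diag (hcS : CellStar) (hdS : DictStar) (hcP : CellPencil) (hdP : DictPencil) (hcB : CellBridge) (hdB : DictBridge)
    (hrec : I_solvesRec) (hinit : I_init)
    (D2 : ExplicitPQAt ![0,0,1,0,1,1,1,1] 2) (D17 : ExplicitPQAt ![0,0,1,0,1,1,0,1] 2) : ExplicitPQAt ![1,0,1,0,1,1,1,1] 1 :=
  Anchor1.explicitPQAt_of_data hcS hdS hcP hdP hcB hdB (aDiag_one ▸ explicitPQAt_aDiag hrec hinit 1) D2 D17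

/-- **`explicitPQ` from THREE level-1 values** — single slot `(1;1,0⁶)`, ghost pair `(1;1,0,0,0,0,1,0)`, top pair `(1;1,0⁵,1)` —
modulo the STAR / PENCIL / BRIDGE contiguity families, the cited invariance (27) and the two named facts `I_solvesRec`, `I_init`
of [BrownZudilin2022, Sect. 2]. [folklore] -/
theorem explicitPQ_of_data3 (hcS : CellStar) (hdS : DictStar) (hcP : CellPencil) (hdP : DictPencil) (hcB : CellBridge)
    (hdB : DictBridge) (hInv : invariance_of_converges') (hrec : I_solvesRec) (hinit : I_init)
    (D2 : ExplicitPQAt ![0,0,1,0,1,1,1,1] 2) (D16 : ExplicitPQAt ![0,0,1,0,1,0,0,1] 2) (D17 : ExplicitPQAt ![0,0,1,0,1,1,0,1] 2) :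
    explicitPQ :=
  explicitPQ_of_data4 hcS hdS hcP hdP hcB hdB hInv (D1_of_diag hcS hdS hcP hdP hcB hdB hrec hinit D2 D17) D2 D16 D17

/-- **`explicitPQ` from three level-1 values, the BRIDGE dictionary relation discharged** by the tree's
`Elimination.dictBridge_holds`. [folklore] -/
theorem explicitPQ_of_data3' (hcS : CellStar) (hdS : DictStar) (hcP : CellPencil) (hdP : DictPencil) (hcB : CellBridge)
    (hInv : invariance_of_converges') (hrec : I_solvesRec) (hinit : I_init)
    (D2 : ExplicitPQAt ![0,0,1,0,1,1,1,1] 2) (D16 : ExplicitPQAt ![0,0,1,0,1,0,0,1] 2) (D17 : ExplicitPQAt ![0,0,1,0,1,1,0,1] 2) :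
    explicitPQ :=
  explicitPQ_of_data3 hcS hdS hcP hdP hcB Elimination.dictBridge_holds hInv hrec hinit D2 D16 D17

end Rows

end Summit.KontsevichZagierPeriods.Zeta5Search.WedgeDictionary

end
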